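import Literature.Barriers.FinalStateConjecture.TrappingDerivativeLossGeodesicBeamsProofs
import HarnessLib

/-!
# Barrier: Sbierski's data-localised trapping obstruction on Kerr — the discharge

Barrier catalogue `Literature/Barriers/FinalStateConjecture` (D-0021). Discharge (librarian,
fact-decomposition pass of 2026-08-16; pure composition, no definition, no named fact) of the
barrier declaration `Literature.Barriers.FinalStateConjecture.SbierskiTrappingObstruction`
(`TrappingDerivativeLoss.lean`: on subextremal Kerr, loss-free uniform local energy decay on a
coordinate ball of radius `R ≥ R₀` fails within the `C^∞` solutions of `□_g ψ = 0` on `{t* > 0}`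
whose data are supported in the ball; J. Sbierski, Anal. PDE 8 (2015), Thm. 7.4 via Thms. 5.5,
5.1 and §7A).

The tree's proof (`TrappingDerivativeLossOrbit.lean`,
`SbierskiTrappingObstruction.of_waveCauchyProblem_of_nullGeodesicBeams`) rests on exactly two
named facts, and both are now theorems: the Cauchy problem for `□_g` on surgered Kerr–Schild
backgrounds (`KerrSchild.waveCauchyProblem_holds`, `KerrSchildWaveCauchyProblemProofs.lean`) and
the Gaussian beams along a null geodesic of the Kerr exterior
(`KerrNullGeodesicGaussianBeams_holds`, `TrappingDerivativeLossGeodesicBeamsProofs.lean`, whose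
appendix already discharges the print-literal form `SbierskiKerrTrappingLED`). No split is needed.

## References

* J. Sbierski, *Characterisation of the energy of Gaussian beams on Lorentzian manifolds: with
  applications to black hole spacetimes*, Anal. PDE 8 (2015) 1379–1420: Thms. 2.1, 4.1, 5.1, 5.5,
  7.4 and §7A. [Sbierski2015]
-/

noncomputable section

namespace Literature.Barriers.FinalStateConjecture

open Literature.Geometry.Lorentzian

/-- **Sbierski's data-localised Kerr trapping obstruction holds** (discharge of the barrier
declaration `SbierskiTrappingObstruction`; Anal. PDE 8 (2015), Thm. 7.4 with Thms. 5.5, 5.1 and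
§7A): the tree's assembly over the Cauchy problem on Kerr–Schild backgrounds and the Gaussian beams
along null geodesics, both proved. [cite: Sbierski2015, Thm. 7.4 (with Thms. 2.1, 4.1, 5.1, 5.5 and §7A)] -/
theorem SbierskiTrappingObstruction_holds : SbierskiTrappingObstruction :=
  SbierskiTrappingObstruction.of_waveCauchyProblem_of_nullGeodesicBeams
    KerrSchild.waveCauchyProblem_holds KerrNullGeodesicGaussianBeams_holds

end Literature.Barriers.FinalStateConjecture

end
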